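import Mathlib
import HarnessLib.Audit
import Summits.PneNP.PneNP.Theorems.PstarMultiUnionSplit
import Summits.PneNP.PneNP.Theorems.PstarPinnedPartners

/-!
# Fibring LOCAL union data over outside variables: pinned slots and untouched outside partners together (ROUND-25, memo §14.29–§14.31)

FRONTIER range-avoidance ladder, rung F-N3, ROUND 25 (cell `pnp-ideate`, planner memo `r24/CORE-BOUND-NOTES.md` §14.29–§14.31; restricted-model proof complexity —
nothing here bears on `P` versus `NP`).

`PstarMultiUnionSplit.multiUnionTerminal_fib` fibres a TERMINAL pair over a set `Zs` of outside variables.  The same construction fibres LOCAL-union-terminal data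
(`PstarMultiUnion.LocalUnionTerminal`) whose shared constraint `w₂` does not touch `Zs`: the base becomes `fib A₀ Zs 0` and the reader releasing `f` becomes the fibre
of its local reader at its own witness.  Composed with the pinned-partner linearisation (`PstarPinnedPartners.localUnionTerminal_of_pinnedPartners`) this settles, by
`PstarLocalUnionFive.localUnionFive_holds`, every terminal core whose `w₂` is hun-clean and whose privates-touching monomials of `w₁` each have a slot PINNED on `Z`
or a slot OUTSIDE `J₀` untouched by `w₂`:

* `localUnionTerminal_fib` — `LocalUnionTerminal (A₀, w₂)`, `Zs` outside `J₀`, `w₂` off `Zs` ⟹ `LocalUnionTerminal (fib A₀ Zs 0, w₂)`;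
* `card_le_five_local_outside` — hence `#J₀ ≤ 5` when the surviving monomials `fibG A₀ Zs` and `w₂`'s are hun-clean;
* `card_le_five_of_pinned_outside` — **Terminal `(w₁, w₂)` + admissible `F` + a set `M` of monomials of `w₁` with pinned slots + a set `Zs` of outside variables
  untouched by `w₂` + every monomial of `w₁` outside `M` with no slot in `Zs` hun-clean + `w₂` hun-clean ⟹ `#J₀ ≤ 5`.**
  (`PstarPinnedPartners.terminalFivePinned_holds` is `Zs = ∅`; `PstarMultiUnionOutside.card_le_five_of_outside_fixed` is `M = ∅`.)

What remains of O2 with `w₂` hun-clean after this file: a privates-touching monomial of `w₁` with both variables free on `Z` whose partner is neither outside-and-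
untouched (an outside partner touched by `w₂`: the DIAG/SHEET classes of `MultiUnionFive`) nor absent (a cross gate: `TerminalFiveCross1Free`; a forest/literal
partner: `TerminalFiveLit`).
-/

set_option linter.dupNamespace false -- `Summit.PneNP.PneNP.…`: summit = sub-problem name (D-0017 single-conjunct layout)

open Finset Literature.Computability.Complexity
open scoped symmDiff
open Summit.PneNP.PneNP.Theorems.PstarFibrePolys (bit bit_injective)
open Summit.PneNP.PneNP.Theorems.PstarTyped (Typed)
open Summit.PneNP.PneNP.Theorems.PstarSALevel (varSet bdry BoundaryExpanding SimpleOverlap)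
open Summit.PneNP.PneNP.Theorems.PstarGapPeeling (eval_congr)
open Summit.PneNP.PneNP.Theorems.PstarCentreFree (vars_mem_varSet)
open Summit.PneNP.PneNP.Theorems.PstarGapOneAll (gval)
open Summit.PneNP.PneNP.Theorems.PstarGConstraint (bit_gval)
open Summit.PneNP.PneNP.Theorems.PstarCoreBound (XorClosed)
open Summit.PneNP.PneNP.Theorems.PstarChordRepair (IsChord)
open Summit.PneNP.PneNP.Theorems.PstarChordBridgeCotree (Peelable)
open Summit.PneNP.PneNP.Theorems.PstarChordBridgeTools (privs)
open Summit.PneNP.PneNP.Theorems.PstarCoreBoundTargets (Terminal)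
open Summit.PneNP.PneNP.Theorems.PstarUnion (SatPair)
open Summit.PneNP.PneNP.Theorems.PstarMultiUnion (Outside fzero LocalUnionTerminal)
open Summit.PneNP.PneNP.Theorems.PstarMultiUnionSplit (lin lcoef fibL fibG fib mem_fibL mem_fibG fibG_subset lin_fzero gval_fib_iff gval_fib_congr
  exists_gate_of_mem_symmDiff)
open Summit.PneNP.PneNP.Theorems.PstarLocalUnionFive (localUnionFive_holds)
open Summit.PneNP.PneNP.Theorems.PstarCross2 (PinnedTo pinA₀)
open Summit.PneNP.PneNP.Theorems.PstarPinnedPartners (localUnionTerminal_of_pinnedPartners)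

namespace Summit.PneNP.PneNP.Theorems.PstarLocalUnionOutside

variable {n m : ℕ}

/-- A constraint that does not touch `Zs` does not see changes on `Zs`. -/
theorem gval_congr_off (I : LocalMap 4 n m) {C : Finset (Fin n)} {G : Finset (Fin m)} {Zs : Finset (Fin n)}
    (hC : ∀ z ∈ Zs, z ∉ C ∧ ∀ g ∈ G, I.vars g 2 ≠ z ∧ I.vars g 3 ≠ z) {x x' : Fin n → Bool} (h : ∀ v, v ∉ Zs → x v = x' v) :
    gval I C G x = gval I C G x' := by
  apply bit_injective
  rw [bit_gval, bit_gval]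
  congr 1
  · exact sum_congr rfl fun v hv => by rw [h v fun hz => (hC v hz).1 hv]
  · refine sum_congr rfl fun g hg => ?_
    rw [h _ fun hz => ((hC _ hz).2 g hg).1 rfl, h _ fun hz => ((hC _ hz).2 g hg).2 rfl]

/-- At the zero index the fibre's linear part is the part of the linear part off `Zs`. -/
theorem mem_fibL_fzero (I : LocalMap 4 n m) (A : Finset (Fin n) × Finset (Fin m) × Bool) (Zs : Finset (Fin n)) {v : Fin n} :
    v ∈ fibL I A Zs (fzero n) ↔ v ∉ Zs ∧ v ∈ A.1 := by
  rw [mem_fibL]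
  unfold lcoef
  rw [lin_fzero, add_zero]
  by_cases h : v ∈ A.1
  · simp [h]
  · simp [h]

/-- **Fibring local union data.**  `LocalUnionTerminal (A₀, w₂)` with `Zs` outside `J₀` and `w₂` touching no variable of `Zs` gives `LocalUnionTerminal (fib A₀ Zs 0, w₂)`:
the reader releasing `f` is the fibre of its local reader at its own witness. -/
theorem localUnionTerminal_fib (I : LocalMap 4 n m) (hT : Typed I) {r : ℕ} {y : Fin m → Bool} {J₀ : Finset (Fin m)}
    {A₀ w₂ : Finset (Fin n) × Finset (Fin m) × Bool} (hU : LocalUnionTerminal I r y J₀ A₀ w₂) {Zs : Finset (Fin n)}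
    (hZ : ∀ z ∈ Zs, Outside I J₀ z) (hw₂ : ∀ z ∈ Zs, z ∉ w₂.1 ∧ ∀ g ∈ w₂.2.1, I.vars g 2 ≠ z ∧ I.vars g 3 ≠ z) :
    LocalUnionTerminal I r y J₀ (fib I A₀ Zs (fzero n)) w₂ := by
  classical
  obtain ⟨hne, hX, hJr, hd₀, hd₂, hcard, hT3, hloc⟩ := hU
  have hG₀ : (fib I A₀ Zs (fzero n)).2.1 = fibG I A₀ Zs := rfl
  -- moving an assignment onto a fibre keeps `J₀` and `w₂`
  have move : ∀ (ξ x : Fin n → Bool), (∀ j ∈ J₀, I.eval x j = y j) → gval I w₂.1 w₂.2.1 x = w₂.2.2 →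
      ∃ x' : Fin n → Bool, (∀ z ∈ Zs, x' z = ξ z) ∧ (∀ v, v ∉ Zs → x v = x' v) ∧ (∀ j ∈ J₀, I.eval x' j = y j) ∧ gval I w₂.1 w₂.2.1 x' = w₂.2.2 := by
    intro ξ x hxJ hxw
    refine ⟨fun v => if v ∈ Zs then ξ v else x v, fun z hz => by simp [hz], fun v hv => by simp [hv], fun j hj => ?_, ?_⟩
    · rw [← hxJ j hj]
      refine eval_congr I j fun s => ?_
      have : I.vars j s ∉ Zs := fun h => hZ _ h j hj (vars_mem_varSet I j s)
      simp [this]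
    · rw [← hxw]
      exact (gval_congr_off I hw₂ fun v hv => by simp [hv]).symm
  refine ⟨hne, hX, hJr, ?_, hd₂, ?_, ?_, fun f hf => ?_⟩
  · rw [hG₀]; exact hd₀.mono_right (fibG_subset I A₀ Zs)
  · rw [hG₀]
    exact (card_le_card (union_subset_union (union_subset_union (Subset.refl J₀) (fibG_subset I A₀ Zs)) (Subset.refl _))).trans hcard
  · -- the base is infeasible
    rintro ⟨x, hxJ, hx1, hx2⟩
    obtain ⟨x', hx'Z, hoff, hx'J, hx'w⟩ := move (fzero n) x hxJ hx2
    refine hT3 ⟨x', hx'J, ?_, hx'w⟩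
    rw [gval_fib_iff I A₀ Zs (fzero n) x' hx'Z, ← gval_fib_congr I A₀ Zs (fzero n) hoff]
    exact hx1
  · -- the reader releasing `f`: the fibre of the local reader at its witness
    obtain ⟨A₁, hG, hlin, hT3₁, x, hxJ, hx1, hx2⟩ := hloc f hf
    refine ⟨fib I A₁ Zs x, ?_, ?_, ?_, ⟨x, hxJ, (gval_fib_iff I A₁ Zs x x fun _ _ => rfl).1 hx1, hx2⟩⟩
    · show fibG I A₁ Zs = fibG I A₀ Zs
      unfold fibG; rw [hG]
    · -- linear parts: through `fib A₁ Zs 0`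
      intro v hv j hj
      have hv' : v ∈ fibL I A₀ Zs (fzero n) ∆ fibL I A₁ Zs x := hv
      by_cases h1 : v ∈ fibL I A₁ Zs (fzero n) ∆ fibL I A₁ Zs x
      · obtain ⟨g, -, hg⟩ := exists_gate_of_mem_symmDiff I A₁ Zs h1
        rcases hg with ⟨h2, -⟩ | ⟨h3, -⟩
        · rw [← h2]; exact ⟨hT j g 0 2 (by decide) (by decide), hT j g 1 2 (by decide) (by decide)⟩
        · rw [← h3]; exact ⟨hT j g 0 3 (by decide) (by decide), hT j g 1 3 (by decide) (by decide)⟩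
      · have h0 : v ∈ fibL I A₀ Zs (fzero n) ∆ fibL I A₁ Zs (fzero n) := by
          rw [mem_symmDiff] at hv' h1 ⊢
          tauto
        rw [mem_symmDiff, mem_fibL_fzero, mem_fibL_fzero] at h0
        have hvA : v ∈ A₀.1 ∆ A₁.1 := by
          rw [mem_symmDiff]; tauto
        exact hlin v hvA j hj
    · -- infeasible on `J₀`
      rintro ⟨z, hzJ, hz1, hz2⟩
      obtain ⟨z', hz'Z, hoff, hz'J, hz'w⟩ := move x z hzJ hz2
      refine hT3₁ ⟨z', hz'J, ?_, hz'w⟩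
      rw [gval_fib_iff I A₁ Zs x z' hz'Z, ← gval_fib_congr I A₁ Zs x hoff]
      exact hz1

/-- **Hence `#J₀ ≤ 5`** when the surviving monomials and `w₂`'s avoid the chord privates (`localUnionFive_holds`). -/
theorem card_le_five_local_outside (I : LocalMap 4 n m) (hI : I.IsPure xorAndPred) (hT : Typed I) (hS : SimpleOverlap I) {r : ℕ}
    (hB : BoundaryExpanding r I) {y : Fin m → Bool} {J₀ : Finset (Fin m)} {A₀ w₂ : Finset (Fin n) × Finset (Fin m) × Bool}
    (hU : LocalUnionTerminal I r y J₀ A₀ w₂) {F : Finset (Fin m)} (hF : F ⊆ J₀) (hP : Peelable I F)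
    (hmax : ∀ F', F ⊆ F' → F' ⊆ J₀ → Peelable I F' → F' = F) (hchord : ∀ e ∈ J₀ \ F, IsChord I J₀ e) {Zs : Finset (Fin n)}
    (hZ : ∀ z ∈ Zs, Outside I J₀ z) (hw₂ : ∀ z ∈ Zs, z ∉ w₂.1 ∧ ∀ g ∈ w₂.2.1, I.vars g 2 ≠ z ∧ I.vars g 3 ≠ z)
    (hclean : ∀ g ∈ fibG I A₀ Zs ∪ w₂.2.1, ∀ v ∈ privs I (J₀ \ F), I.vars g 2 ≠ v ∧ I.vars g 3 ≠ v) : J₀.card ≤ 5 :=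
  localUnionFive_holds n m r I hI hT hS hB y J₀ _ w₂ (localUnionTerminal_fib I hT hU hZ hw₂) F hF hP hmax hchord hclean

/-- **PINNED SLOTS AND UNTOUCHED OUTSIDE PARTNERS TOGETHER.**  A terminal core with admissible `F`; a set `M` of monomials of `w₁` each with a slot pinned on `Z`;
a set `Zs` of variables outside `J₀` untouched by `w₂`; every monomial of `w₁` outside `M` with no slot in `Zs`, and every monomial of `w₂`, avoiding the chord
privates.  Then `#J₀ ≤ 5`. -/
theorem card_le_five_of_pinned_outside (I : LocalMap 4 n m) (hI : I.IsPure xorAndPred) (hT : Typed I) (hS : SimpleOverlap I) {r : ℕ}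
    (hB : BoundaryExpanding r I) {y : Fin m → Bool} {J₀ : Finset (Fin m)} {w₁ w₂ : Finset (Fin n) × Finset (Fin m) × Bool}
    (ht : Terminal I r y J₀ w₁ w₂) {F : Finset (Fin m)} (hF : F ⊆ J₀) (hP : Peelable I F)
    (hmax : ∀ F', F ⊆ F' → F' ⊆ J₀ → Peelable I F' → F' = F) (hchord : ∀ e ∈ J₀ \ F, IsChord I J₀ e)
    {M : Finset (Fin m)} (hM : M ⊆ w₁.2.1) {sl : Fin m → Fin 4} (hsl : ∀ g ∈ M, sl g = 2 ∨ sl g = 3) {c : Fin m → Bool}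
    (hpin : ∀ g ∈ M, PinnedTo I y J₀ w₂ (I.vars g (sl g)) (c g)) {Zs : Finset (Fin n)} (hZ : ∀ z ∈ Zs, Outside I J₀ z)
    (hw₂ : ∀ z ∈ Zs, z ∉ w₂.1 ∧ ∀ g ∈ w₂.2.1, I.vars g 2 ≠ z ∧ I.vars g 3 ≠ z)
    (hclean : ∀ g ∈ ((w₁.2.1 \ M).filter fun g => I.vars g 2 ∉ Zs ∧ I.vars g 3 ∉ Zs) ∪ w₂.2.1,
      ∀ v ∈ privs I (J₀ \ F), I.vars g 2 ≠ v ∧ I.vars g 3 ≠ v) : J₀.card ≤ 5 :=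
  card_le_five_local_outside I hI hT hS hB (localUnionTerminal_of_pinnedPartners I hI hT ht hM hsl hpin) hF hP hmax hchord hZ hw₂ hclean

end Summit.PneNP.PneNP.Theorems.PstarLocalUnionOutside
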